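import Summits.BirchSwinnertonDyer.Rank1Residual.X2.GreenbergVatsalUnramifiedAway
import Summits.BirchSwinnertonDyer.BirchSwinnertonDyer.Theorems.SignedBaseChangeAnticyclotomicEisensteinDivisibilityAdmdefRamifiedBaseChange
import Literature.NumberTheory.EllipticCurves.HeegnerPointsKolyvaginCebotarevProofs
import Literature.NumberTheory.EllipticCurves.SelmerCorankControlRatProofs
import Literature.NumberTheory.EllipticCurves.OpenImageMazurCharacterProofs
import Literature.NumberTheory.EllipticCurves.SelmerPInftyRestriction
import HarnessLib

/-!
# Route `SignedLowerHalves`, crux L `SmallImageLowerHalfBothSigns` (stmt-BirchSwinnertonDyer-23599), line `rtt_w3` v12 — glue brick (d2) «INERTIA AT AN UNRAMIFIED PRIME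
# LIES IN `Γ_K`»: for a quadratic field `K` and a finite place `v` of `ℚ` whose prime does not divide `d_K`, the inertia group `I_v ≤ Γ_ℚ` (the tree's
# `GreenbergSelmer.inertia v`) is contained in `galRange K` = the image of `Γ_K`; and the `S₀`-form consumed by -w3 g17's DESC-away brick
# (`corH1_resH1Hom_mem_unramifiedOutside`, p767858, hypothesis `hI`): under the registered stub's `hbad` (primes of `d_K · N𝔪` are bad for `W`) and `hS₀bad`
# (bad places lie in `S₀`), every `v ∉ S₀` has `I_v ≤ galRange K`.

LEAD `cruxlead-stmt-BirchSwinnertonDyer-23599` g7 (cell `bsd-ssimc`; `--supports stmt-BirchSwinnertonDyer-23599 --as helper`). THEOREMS ONLY (no definition, no named fact,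
no instance, no `sorry`); assembled from tree lemmas (Dedekind's discriminant theorem `isUnramifiedIn_ringOfIntegers_of_not_dvd_discr`, `inertia_le_range_absGaloisRestrict_of_isUnramifiedIn`,
`inertia_adicCompletionPrime_eq_map_absInertia`, `resGal_eq_absGaloisRestrict`). BSD / crux L / INJ_top are NOT proved here.

WHAT: ★ `inertia_le_galRange_of_not_dvd_discr`, ★ `inertia_le_galRange_of_not_mem` (the `hI` of p767858 from `hbad` + `hS₀bad`).

References: [NeukirchANT1999] Ch. III §2 Cor. (2.12), Ch. I §9 (9.6); [SerreGaloisCohomology1997] II §1.1.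
-/

set_option autoImplicit false
set_option linter.dupNamespace false -- D-0017: single-problem summit, the namespace repeats the problem name by design
noncomputable section

open scoped Classical

namespace Summit.BirchSwinnertonDyer.BirchSwinnertonDyer.Theorems.SmallImageCharSignedSelmer

open NumberField IsDedekindDomain Field Literature.NumberTheory.EllipticCurves Literature.NumberTheory.EllipticCurves.GreenbergSelmer
  Literature.NumberTheory.GaloisRepresentations Rat.HeightOneSpectrum WeierstrassCurve

/-- ★ **`I_v ≤ galRange K` when the prime `q` under `v` does not divide `d_K`** (`K` quadratic, hence Galois: `v` is unramified in `K`, so inertia fixes `K`).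
[cite: NeukirchANT1999, Ch. III §2 Cor. (2.12), Ch. I §9 (9.6)] -/
theorem inertia_le_galRange_of_not_dvd_discr (K : Type) [Field K] [NumberField K] (hK2 : Module.finrank ℚ K = 2)
    {v : HeightOneSpectrum (𝓞 ℚ)} {q : ℕ} (hq : q.Prime) (hqv : ((q : ℕ) : 𝓞 ℚ) ∈ v.asIdeal) (hnd : ¬ (q : ℤ) ∣ NumberField.discr K) :
    inertia v ≤ galRange (K := ℚ) K := by
  haveI : Algebra.IsQuadraticExtension ℚ K := { finrank_eq_two' := hK2 }
  haveI : IsAbelianGalois ℚ K := {}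
  have hunr := SignedBaseChangeAcDivAdmdefRamifiedBaseChange.isUnramifiedIn_ringOfIntegers_of_not_dvd_discr K v hq hqv hnd
  have hI := inertia_le_range_absGaloisRestrict_of_isUnramifiedIn (K := K) hunr (adicCompletionPrime_mem_primesAbove ℚ v)
  intro x hx
  have hx' : x ∈ (adicCompletionPrime ℚ v).inertia (absoluteGaloisGroup ℚ) := by
    rw [inertia_adicCompletionPrime_eq_map_absInertia]; exact hx
  obtain ⟨τ, hτ⟩ := hI hx'
  exact ⟨τ, by rw [resGal_eq_absGaloisRestrict]; exact hτ⟩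

/-- ★ **The `hI` of DESC-away from the stub's hypotheses**: `K` quadratic; every prime dividing `d_K · N𝔪` is bad for `W` (`hbad`); every bad place is in `S₀` (`hS₀bad`).
Then `I_v ≤ galRange K` for every finite place `v ∉ S₀` (the prime under `v` is good, hence prime to `d_K`). [cite: NeukirchANT1999, Ch. III §2 Cor. (2.12)] -/
theorem inertia_le_galRange_of_not_mem (W : WeierstrassCurve ℚ) (K : Type) [Field K] [NumberField K] (hK2 : Module.finrank ℚ K = 2) (𝔪 : Ideal (𝓞 K))
    (hbad : ∀ (ℓ : ℕ) [Fact ℓ.Prime], ℓ ∣ (NumberField.discr K).natAbs * Ideal.absNorm 𝔪 → ¬ W.HasGoodReductionAtPrime ℓ)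
    (S₀ : Finset (HeightOneSpectrum (𝓞 ℚ))) (hS₀bad : ∀ v : HeightOneSpectrum (𝓞 ℚ), ¬ W.HasGoodReductionAt v → v ∈ S₀)
    {v : HeightOneSpectrum (𝓞 ℚ)} (hv : v ∉ (S₀ : Set (HeightOneSpectrum (𝓞 ℚ)))) :
    inertia v ≤ galRange (K := ℚ) K := by
  have hgood : W.HasGoodReductionAt v := by
    by_contra h
    exact hv (Finset.mem_coe.2 (hS₀bad v h))
  haveI : Fact (natGenerator v).Prime := ⟨prime_natGenerator v⟩
  have hqv : ((natGenerator v : ℕ) : 𝓞 ℚ) ∈ v.asIdeal := Mazur1978.natCast_natGenerator_mem_asIdeal v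
  have hgood' : W.HasGoodReductionAtPrime (natGenerator v) := W.hasGoodReductionAtPrime_of_hasGoodReductionAt v hqv hgood
  refine inertia_le_galRange_of_not_dvd_discr K hK2 (prime_natGenerator v) hqv fun hdvd ↦ ?_
  refine hbad (natGenerator v) ?_ hgood'
  exact Dvd.dvd.mul_right (Int.natCast_dvd.mp hdvd) _

end Summit.BirchSwinnertonDyer.BirchSwinnertonDyer.Theorems.SmallImageCharSignedSelmer

end
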